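import Summits.BirchSwinnertonDyer.BirchSwinnertonDyer.Theorems.Rank2Observatory916c1TwoDescRankTwo
import Summits.BirchSwinnertonDyer.BirchSwinnertonDyer.Theorems.ShaPrimaryTransferFiniteShaComponentTransferSelmerCubicDoor
import Literature.NumberTheory.EllipticCurves.KubertTateSevenRational
import HarnessLib

/-!
# BirchSwinnertonDyer — `t₂(916c1) = 0`, `Ш(916c1/ℚ)[2^∞] = 0`, `rank = 2` by the `2`-SELMER upgrade of the kernel general
# `2`-descent (SEL2CUBIC door, totally real cubic `2`-division field)

HONEST FRAMING: a per-curve certified theorem; no claim on BSD in rank ≥ 2. Route `ShaPrimaryTransfer`, seat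
`bsd-line-spt-p1`; item T = `FiniteShaComponentTransfer` (stmt-22356) UNCHANGED (conjecture-grade at corank ≥ 2).
THEOREMS ONLY; generated from the cell-`b2b-bsdr2` certificate `Rank2Observatory916c1TwoDescRankTwo` (model
`(⟨0, 0, 0, -4, 1⟩ : WeierstrassCurve ℚ)`, field `CubicField (-6) 8 (-1)`, three-real-place sieve `admStd3R`, residue moduli `[]`) by
`shaCorank_two_eq_zero_of_admStd3RQ` (`…SelmerCubicDoor`): the certificate's own side data
(norms, sign bits, generator primes, support of `F′(θ)`, units modulo squares, kernel count of admissible pairs `≤ 4`)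
and its rank lower bound give, for ALL of `Sel⁽²⁾(E/ℚ)` instead of `E(ℚ)/2E(ℚ)`:

* **`sha_door`** — `t₂(E) = 0 ∧ Ш(E/ℚ)[2^∞] = 0 ∧ rank E(ℚ) = 2` for the model `(⟨0, 0, 0, -4, 1⟩ : WeierstrassCurve ℚ)`;
* `shaCorank_two_eq_zero`, `primaryComponent_sha_two_eq_bot`; `shaCorank_two_eq_zero_cremona` for Cremona's model
  `⟨0, 0, 0, -4, 1⟩` (variable change `variableChange_smul`).

UNCONDITIONAL (complete `2`-descent; no `L`-function, no Gross–Zagier–Kolyvagin). BSD is NOT proved by this.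
[cite: Cassels1991LecturesEllipticCurves, §15] [cite: CremonaAlgorithms1997, §3.6 and §3.5 (Cremona label `916c1`)]
[cite: SilvermanAEC2009, Thm. X.4.2]
-/

-- single-conjunct summit: `Summit.BirchSwinnertonDyer.BirchSwinnertonDyer.…` repeats the name by design
set_option linter.dupNamespace false

noncomputable section

open scoped Classical NumberField

open Literature.NumberTheory.NumberFields Literature.NumberTheory.EllipticCurves
  Literature.NumberTheory.GaloisRepresentations Polynomial Module NumberField IsDedekindDomain
open WeierstrassCurve WeierstrassCurve.Affine

namespace Summit.BirchSwinnertonDyer.BirchSwinnertonDyer.Theorems.ShaPrimaryTransferSelmerCubic916c1Sha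

open Summit.BirchSwinnertonDyer.BirchSwinnertonDyer.Rank2Observatory
open Summit.BirchSwinnertonDyer.BirchSwinnertonDyer.Rank2Observatory.TwoDescCubic
open Summit.BirchSwinnertonDyer.BirchSwinnertonDyer.Rank2Observatory.TwoDescCubic.FieldR229
open Summit.BirchSwinnertonDyer.BirchSwinnertonDyer.Rank2Observatory.C916c1
open Summit.BirchSwinnertonDyer.BirchSwinnertonDyer.Theorems.ShaPrimaryTransferSelmerCubicCover

/-- `E_K` is elliptic over the cubic `2`-division field. [cite: CremonaAlgorithms1997, §3.5 (Cremona label `916c1`)] -/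
theorem isElliptic_baseChange : ((⟨0, 0, 0, -4, 1⟩ : WeierstrassCurve ℚ).baseChange (CubicField (-6) 8 (-1))).IsElliptic :=
  haveI := isElliptic
  (⟨0, 0, 0, -4, 1⟩ : WeierstrassCurve ℚ).isElliptic_baseChange (CubicField (-6) 8 (-1))

/-- Cremona's model `⟨0, 0, 0, -4, 1⟩` of `916c1` and the certificate's model `(⟨0, 0, 0, -4, 1⟩ : WeierstrassCurve ℚ)` differ by an admissible change of
variables over `ℚ` (identity).
[cite: CremonaAlgorithms1997, §3.5 (Cremona label `916c1`)] -/
theorem variableChange_smul :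
    (1 : WeierstrassCurve.VariableChange ℚ) •
      ((⟨0, 0, 0, -4, 1⟩ : WeierstrassCurve ℤ).map (Int.castRingHom ℚ)) = (⟨0, 0, 0, -4, 1⟩ : WeierstrassCurve ℚ) := by
    rw [one_smul]
    ext <;> simp [WeierstrassCurve.map]

/-- **The SEL2CUBIC door for `916c1`**: `t₂(E) = corank_{ℤ₂} Ш(E/ℚ)[2^∞] = 0`, `Ш(E/ℚ)[2^∞] = 0` and
`rank E(ℚ) = 2` for the model `(⟨0, 0, 0, -4, 1⟩ : WeierstrassCurve ℚ)` — UNCONDITIONAL (`#Sel⁽²⁾(E/ℚ) ≤ 4` by the Selmer cover of the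
certificate's sieve, `rank ≥ 2` from the certificate). [cite: Cassels1991LecturesEllipticCurves, §15]
[cite: SilvermanAEC2009, Thm. X.4.2, Rem. X.4.1] -/
theorem sha_door :
    (⟨0, 0, 0, -4, 1⟩ : WeierstrassCurve ℚ).shaCorank 2 = 0 ∧ AddCommGroup.primaryComponent (⟨0, 0, 0, -4, 1⟩ : WeierstrassCurve ℚ).sha 2 = ⊥ ∧
      (⟨0, 0, 0, -4, 1⟩ : WeierstrassCurve ℚ).mordellWeilRank = 2 := by
  haveI := isElliptic
  haveI := isElliptic_baseChange
  obtain ⟨σ₁, hσ₁lo, hσ₁hi⟩ := FieldR229.exists_rho3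
  obtain ⟨σ₂, hσ₂lo, hσ₂hi⟩ := FieldR229.exists_rho2
  obtain ⟨σ₃, hσ₃lo, hσ₃hi⟩ := FieldR229.exists_rho1
  have hGi : Function.Injective (![lin aeval_α 8 (-12) 3] : Fin 1 → 𝓞 (CubicField (-6) 8 (-1))) := by
    intro i j h
    fin_cases i; fin_cases j
    · rfl
  have hGp : ∀ j, Prime ((![lin aeval_α 8 (-12) 3] : Fin 1 → 𝓞 (CubicField (-6) 8 (-1))) j) := by
    intro j
    fin_cases j
    · exact TwoDescCubic.FieldR229.e_8_m12_3_prime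
  have h12 : σ₁ (algebraMap (𝓞 (CubicField (-6) 8 (-1))) (CubicField (-6) 8 (-1)) (lin aeval_α 2 (-1) 0)) < σ₂ (algebraMap (𝓞 (CubicField (-6) 8 (-1))) (CubicField (-6) 8 (-1)) (lin aeval_α 2 (-1) 0)) :=
    lin_lt_lin aeval_α σ₁ σ₂ (by norm_num) hσ₁lo hσ₁hi (by norm_num) hσ₂lo hσ₂hi 2 (-1) 0
      (by norm_num)
  have h23 : σ₂ (algebraMap (𝓞 (CubicField (-6) 8 (-1))) (CubicField (-6) 8 (-1)) (lin aeval_α 2 (-1) 0)) < σ₃ (algebraMap (𝓞 (CubicField (-6) 8 (-1))) (CubicField (-6) 8 (-1)) (lin aeval_α 2 (-1) 0)) :=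
    lin_lt_lin aeval_α σ₂ σ₃ (by norm_num) hσ₂lo hσ₂hi (by norm_num) hσ₃lo hσ₃hi 2 (-1) 0
      (by norm_num)
  have hrank : 2 ≤ (⟨0, 0, 0, -4, 1⟩ : WeierstrassCurve ℚ).mordellWeilRank := by
    rw [← mordellWeilRank_eq_of_smul_eq _ _ _ variableChange_smul, C916c1.mordellWeilRank_eq_two]
  refine shaCorank_two_eq_zero_of_admStd3RQ (A := 0) (B := (-4)) (C := 1) (⟨0, 0, 0, -4, 1⟩ : WeierstrassCurve ℚ) rfl (by norm_num) rfl
    (by norm_num) (by norm_num) irreducible_F aeval_theta finrank_eq σ₁ σ₂ σ₃ h12 h23 hGi hGp support_deriv units_span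
    (Nu := (![-1, -1, 1] : Fin 3 → ℤ)) (Ng := (![-229] : Fin 1 → ℤ)) (su₁ := (![true, true, false] : Fin 3 → Bool)) (su₂ := (![true, false, false] : Fin 3 → Bool)) (su₃ := (![true, false, false] : Fin 3 → Bool)) (sg₁ := (![false] : Fin 1 → Bool)) (sg₂ := (![true] : Fin 1 → Bool)) (sg₃ := (![false] : Fin 1 → Bool))
    ?_ ?_ ?_ ?_ ?_ ?_ ?_ ?_ [] (by decide) (r := 2) (by decide +kernel) hrank
  · intro i
    exact units_norm i
  · intro j
    fin_cases j
    · exact TwoDescCubic.FieldR229.e_8_m12_3_norm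
  · intro i
    have h := units_sign3 σ₁ hσ₁lo hσ₁hi i
    fin_cases i <;> simpa using h
  · intro i
    have h := units_sign2 σ₂ hσ₂lo hσ₂hi i
    fin_cases i <;> simpa using h
  · intro i
    have h := units_sign1 σ₃ hσ₃lo hσ₃hi i
    fin_cases i <;> simpa using h
  · intro j
    fin_cases j
    · simpa using (lin_pos aeval_α σ₁ (by norm_num) hσ₁lo hσ₁hi 8 (-12) 3 (by norm_num)).le
  · intro j
    fin_cases j
    · simpa using lin_neg aeval_α σ₂ (by norm_num) hσ₂lo hσ₂hi 8 (-12) 3 (by norm_num)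
  · intro j
    fin_cases j
    · simpa using (lin_pos aeval_α σ₃ (by norm_num) hσ₃lo hσ₃hi 8 (-12) 3 (by norm_num)).le

/-- **`t₂(916c1) = 0`** (model `(⟨0, 0, 0, -4, 1⟩ : WeierstrassCurve ℚ)`), UNCONDITIONAL. [cite: SilvermanAEC2009, Thm. X.4.2] -/
theorem shaCorank_two_eq_zero : (⟨0, 0, 0, -4, 1⟩ : WeierstrassCurve ℚ).shaCorank 2 = 0 := sha_door.1

/-- **`Ш(916c1/ℚ)[2^∞] = 0`** (model `(⟨0, 0, 0, -4, 1⟩ : WeierstrassCurve ℚ)`), UNCONDITIONAL. [cite: SilvermanAEC2009, Thm. X.4.2] -/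
theorem primaryComponent_sha_two_eq_bot : AddCommGroup.primaryComponent (⟨0, 0, 0, -4, 1⟩ : WeierstrassCurve ℚ).sha 2 = ⊥ := sha_door.2.1

/-- **`rank 916c1(ℚ) = 2` re-derived through the Selmer bound** (model `(⟨0, 0, 0, -4, 1⟩ : WeierstrassCurve ℚ)`).
[cite: CremonaAlgorithms1997, §3.5 (Cremona label `916c1`)] -/
theorem mordellWeilRank_eq_two' : (⟨0, 0, 0, -4, 1⟩ : WeierstrassCurve ℚ).mordellWeilRank = 2 := sha_door.2.2

/-- **`t₂(916c1) = 0` for Cremona's model `⟨0, 0, 0, -4, 1⟩`** (`t_p` is an isomorphism invariant,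
`shaCorank_eq_zero_iff_of_smul_eq`). UNCONDITIONAL; BSD for `916c1` is NOT claimed.
[cite: CremonaAlgorithms1997, §3.5 (Cremona label `916c1`)] [cite: SilvermanAEC2009, Thm. X.4.2] -/
theorem shaCorank_two_eq_zero_cremona : ((⟨0, 0, 0, -4, 1⟩ : WeierstrassCurve ℤ).map (Int.castRingHom ℚ)).shaCorank 2 = 0 := by
  haveI := isElliptic
  haveI : ((⟨0, 0, 0, -4, 1⟩ : WeierstrassCurve ℤ).map (Int.castRingHom ℚ)).IsElliptic := by
    rw [← inv_smul_smul (1 : WeierstrassCurve.VariableChange ℚ) ((⟨0, 0, 0, -4, 1⟩ : WeierstrassCurve ℤ).map (Int.castRingHom ℚ)), variableChange_smul]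
    infer_instance
  exact (shaCorank_eq_zero_iff_of_smul_eq _ _ _ variableChange_smul 2).mpr shaCorank_two_eq_zero

end Summit.BirchSwinnertonDyer.BirchSwinnertonDyer.Theorems.ShaPrimaryTransferSelmerCubic916c1Sha

end
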